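import Summits.BirchSwinnertonDyer.Rank1Residual.Additive.BudgetFromRelaxedKummerCount
import HarnessLib

/-!
# The JOINT relaxed-Kummer count: `#H¹_𝓖(K, E[p]) ≥ p^{#T₀} · #H¹_{𝓖*}(K, E[p]^D) ≥ p^{#T₀} · #S₀`
# (row T-E3g-JOINT, FILE J-A; r2's ST-18.2 global half = ST-20.6; seat p10 GEN 5)

HONEST FRAMING (cell `b2b-bsdres`, run/shared/lean/b2b/bsd-rank1-residual/, verbatim in every
file): the goal of the cell is to DELETE the COMBINATION-SHAPED residual classes of the
Birch–Swinnerton-Dyer formula for ALL analytic-rank `≤ 1` elliptic curves over `ℚ` — "full BSD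
formula for every rank `≤ 1` curve in class `C`" assembled STRICTLY from published theorems — so
that the rank-`≤ 1` remainder becomes exactly the CONSTRUCTION-SHAPED classes, which are TYPED
(missing-input `Prop`s), NOT attempted. This is not "finishing BSD". Team n1011 (N10/N11, the
Route-G LOWER budget node of the CONSTRUCTION-SHAPED classes X3♯/X4♯): research route; a
SIZING / supplier theorem, OPTIONAL per ROUTE-2 II.20 (ST-20.6); nothing is booked by this file;
no mark / label moved. THEOREMS ONLY: no definition, no named fact, no `sorry`.

## What (ROUTE-2 II.18.4 STEP 3, the "joint door" `b₀ = t₀ + s₀`)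

FILE 4a (`BudgetFromRelaxedKummerCount`, p266156) counted the Selmer group of the Kummer structure
`𝓚` RELAXED by the unramified classes at a finite set `T₀` of Tamagawa-witness places:
`#H¹_𝓖 ≥ p^{#T₀}`, from the pair-counting identity `#H¹_𝓖 · ∏_T #𝓚_v = #H¹_{𝓖*} · ∏_T #𝓖_v`
(p13 `card_selmerGroup_pair` + p18 `natCard_selmerGroup_kummer_eq_dual`) in which the factor
`#H¹_{𝓖*}(K, E[p]^D)` was DROPPED.  THIS FILE keeps it:

* §1 `finite_and_pow_mul_card_dual_le_card_selmerGroup_of_kummer_le` —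
  `p^{#T₀} · #H¹_{𝓖*} ≤ #H¹_𝓖` (same hypotheses as FILE 4a §3);
* §2 `natCard_strict_le_natCard_dualSelmerGroup` — for ANY structure `𝓖` agreeing with `𝓚` at the
  finite places off `T₀`: the Weil transport `θ_*` (p18's `map_weilDual_mem_dualSelmerGroup`
  mechanism, X11b `weilDualIntertwining`) maps the STRICT-at-`T₀` Selmer classes
  `S₀ = {x ∈ H¹_𝓚(K, E[p]) : loc_v x = 0, v ∈ T₀}` injectively into `H¹_{𝓖*}(K, E[p]^D)`:
  `#S₀ ≤ #H¹_{𝓖*}`;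
* §3 `exists_addSubgroup_relaxedKummer_joint` — FILE 4a §4 re-run with the joint count: a finite
  `S ≤ H¹(K, E[p])` with `p^{#T₀} · #S₀ ≤ #S` and the same three local clauses (Kummer off `T₀`
  and at ∞, `H¹_ur ⊔ 𝓚_v` on `T₀`).

The census reads `#S₀ = p^{s₀}`, `s₀ = d − rk(loc_{T₀})`, off one descent WITH local images
(x11c certificates; r2 `route2/g14/SIGMA-s0.tsv`): EVIDENCE, entering FILE J-B as a hypothesis.
HONEST LIMITS: a LOWER bound only (no exactness; the local exactness at `v ∤ p` is row
T-E3g-DOOR, n1011-p06); binders = FILE 4a's (PT family, local Euler–Poincaré, `p` odd).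

References: Wiles 1995 Prop. 1.6 / DDT 1997 Thm. 2.19 (pair counting); Milne *ADT* I Cor. 2.3,
Thm. 2.6, §6; R. Greenberg, LNM 1716 (1999) §5 pp. 114–118 [GreenbergLNM1716].
-/

set_option autoImplicit false

open scoped Classical
open Function NumberField IsDedekindDomain WeierstrassCurve
open Literature.NumberTheory.EllipticCurves Literature.NumberTheory.GaloisRepresentations
open Literature.NumberTheory.GaloisRepresentations.DiscreteGaloisModule (SelmerStructure unramifiedSubgroup)
open Literature.NumberTheory.GaloisCohomology
open Summit.BirchSwinnertonDyer.Rank1Residual.GaloisImage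
open Summit.BirchSwinnertonDyer.Rank1Residual.X11b.Levels Summit.BirchSwinnertonDyer.Rank1Residual.X11b.LocBridge

universe u

namespace Summit.BirchSwinnertonDyer.Rank1Residual.Additive

/-! ### §1 The count with the dual factor kept -/

section Count

variable {K : Type u} [Field K] [NumberField K] (W : WeierstrassCurve K) [W.IsElliptic] (p : ℕ)
  [hp : Fact p.Prime]

/-- **Pair counting against the Kummer structure, dual factor KEPT.** Under the hypotheses of
FILE 4a's `finite_and_pow_le_card_selmerGroup_of_kummer_le` (`p` odd, PT family `inv`, local
Euler–Poincaré, `𝓚 ≤ 𝓖` agreeing at ∞ and unramified outside `S(T)`, `#𝓖_v ≥ p · #𝓚_v` on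
`T₀ ⊆ T`): `H¹_𝓖(K, E[p])` and `H¹_{𝓖*}(K, E[p]^D)` are finite and
`p^{#T₀} · #H¹_{𝓖*} ≤ #H¹_𝓖` — from `#H¹_𝓖 · ∏_T #𝓚_v = #H¹_{𝓖*} · ∏_T #𝓖_v`
(`card_selmerGroup_pair`, `natCard_selmerGroup_kummer_eq_dual`) and
`∏_T #𝓖_v ≥ p^{#T₀} ∏_T #𝓚_v`. [folklore] -/
theorem finite_and_pow_mul_card_dual_le_card_selmerGroup_of_kummer_le (hodd : p ≠ 2)
    (inv : LocalInvariants K p) (hperf : inv.IsPerfect) (hsum : inv.SumLocalTermEqZero)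
    (hcompl : inv.SelmerComplement)
    (hEP : ∀ v : HeightOneSpectrum (𝓞 K), localEulerPoincareCharacteristic (v.adicCompletion K))
    (T : Finset (HeightOneSpectrum (𝓞 K)))
    (hS : ∀ v ∉ T, ((p : ℕ) : 𝓞 K) ∉ v.asIdeal ∧
      GaloisRep.IsUnramifiedAt v (W.torsionGaloisModule (p : ℤ)))
    (h𝓚 : (W.kummerSelmerStructure (p : ℤ)).IsUnramifiedOutside (finSupport T))
    {𝓖 : SelmerStructure (W.torsionGaloisModule (p : ℤ))} (hle : W.kummerSelmerStructure (p : ℤ) ≤ 𝓖)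
    (h𝓖 : 𝓖.IsUnramifiedOutside (finSupport T))
    (hinf : ∀ w : InfinitePlace K, W.kummerSelmerStructure (p : ℤ) (Sum.inl w) = 𝓖 (Sum.inl w))
    (T₀ : Finset (HeightOneSpectrum (𝓞 K))) (hT₀ : T₀ ⊆ T)
    (hbig : ∀ v ∈ T₀, p * Nat.card (W.kummerSelmerStructure (p : ℤ) (Sum.inr v)) ≤
      Nat.card (𝓖 (Sum.inr v))) [Finite (geomTorsion W (p : ℤ))] :
    Finite 𝓖.selmerGroup ∧
      Finite (inv.dualSelmerStructure (W.torsionGaloisModule (p : ℤ)) 𝓖).selmerGroup ∧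
      p ^ T₀.card *
          Nat.card (inv.dualSelmerStructure (W.torsionGaloisModule (p : ℤ)) 𝓖).selmerGroup ≤
        Nat.card 𝓖.selmerGroup := by
  haveI : NeZero p := ⟨hp.out.ne_zero⟩
  -- `Sel⁽ᵖ⁾(E/K) = H¹_𝓚(K, E[p])` is finite
  haveI hfinK : Finite (W.kummerSelmerStructure (p : ℤ)).selmerGroup := by
    rw [← selmerGroup_eq_selmerGroup_kummerSelmerStructure]
    exact finite_selmerGroup_holds W (by exact_mod_cast hp.out.ne_zero)
  -- the Weil pairing and the self-duality count `#H¹_𝓚 = #H¹_{𝓚*}`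
  obtain ⟨e, hμ, hadd₁, hadd₂, halt, hnondeg, hgal⟩ :=
    exists_weilPairing_holds W p hp.out.two_le (Nat.cast_ne_zero.mpr hp.out.ne_zero)
  have hinv : ∀ v : HeightOneSpectrum (𝓞 K), Injective (inv (Sum.inr v)) :=
    fun v ↦ (hperf v).1.injective
  have hself := natCard_selmerGroup_kummer_eq_dual W p e hμ hadd₁ hadd₂ hgal halt hnondeg
    hp.out.isPrimePow (hp.out.odd_of_ne_two hodd) inv hinv hEP
  -- pair counting
  have hM : ∀ m : geomTorsion W (p : ℤ), p • m = 0 := fun m ↦ Subtype.ext <| by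
    rw [AddSubgroupClass.coe_nsmul, ZeroMemClass.coe_zero]
    exact AddSubgroup.torsionBy.nsmul_iff.mp m.2
  have hpair := card_selmerGroup_pair (W.torsionGaloisModule (p : ℤ)) T inv hperf hsum hcompl
    hM hS hle h𝓚 h𝓖 hinf
  rw [← hself] at hpair
  -- positivity of the factors
  have ha : 0 < Nat.card (W.kummerSelmerStructure (p : ℤ)).selmerGroup := Nat.card_pos
  haveI : Finite (inv.dualSelmerStructure (W.torsionGaloisModule (p : ℤ))
      (W.kummerSelmerStructure (p : ℤ))).selmerGroup :=
    Nat.finite_of_card_ne_zero (hself ▸ ha.ne')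
  haveI hfinGd : Finite (inv.dualSelmerStructure (W.torsionGaloisModule (p : ℤ)) 𝓖).selmerGroup :=
    Finite.of_injective _ (AddSubgroup.inclusion_injective
      (LocalInvariants.selmerGroup_dualSelmerStructure_anti inv (W.torsionGaloisModule (p : ℤ)) hle))
  have hlocfin : ∀ v : HeightOneSpectrum (𝓞 K),
      Finite (galoisCohomology ((W.torsionGaloisModule (p : ℤ)).toLocal (Sum.inr v)) 1) :=
    fun v ↦ finite_galoisCohomology_one_toLocal _ v
  have hPK : 0 < ∏ v ∈ T, Nat.card (W.kummerSelmerStructure (p : ℤ) (Sum.inr v)) := by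
    refine Finset.prod_pos fun v _ ↦ ?_
    haveI := hlocfin v
    exact Nat.card_pos
  -- `∏_T #𝓖_v ≥ p^{#T₀} · ∏_T #𝓚_v`
  have hprod : p ^ T₀.card * ∏ v ∈ T, Nat.card (W.kummerSelmerStructure (p : ℤ) (Sum.inr v)) ≤
      ∏ v ∈ T, Nat.card (𝓖 (Sum.inr v)) := by
    have hc : ∏ v ∈ T, (if v ∈ T₀ then p else 1) = p ^ T₀.card := by
      rw [Finset.prod_ite_mem, Finset.inter_eq_right.mpr hT₀, Finset.prod_const]
    rw [← hc, ← Finset.prod_mul_distrib]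
    refine Finset.prod_le_prod (fun v _ ↦ Nat.zero_le _) fun v _ ↦ ?_
    haveI := hlocfin v
    split_ifs with hv
    · exact hbig v hv
    · rw [one_mul]
      exact AddSubgroup.card_le_of_le (hle (Sum.inr v))
  -- the identity `#H¹_𝓖 · ∏ #𝓚_v = #H¹_{𝓖*} · ∏ #𝓖_v`
  have h1 : Nat.card 𝓖.selmerGroup *
      ∏ v ∈ T, Nat.card (W.kummerSelmerStructure (p : ℤ) (Sum.inr v)) =
      Nat.card (inv.dualSelmerStructure (W.torsionGaloisModule (p : ℤ)) 𝓖).selmerGroup *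
        ∏ v ∈ T, Nat.card (𝓖 (Sum.inr v)) := by
    refine Nat.eq_of_mul_eq_mul_left ha ?_
    calc Nat.card (W.kummerSelmerStructure (p : ℤ)).selmerGroup * (Nat.card 𝓖.selmerGroup *
            ∏ v ∈ T, Nat.card (W.kummerSelmerStructure (p : ℤ) (Sum.inr v)))
        = Nat.card 𝓖.selmerGroup * Nat.card (W.kummerSelmerStructure (p : ℤ)).selmerGroup *
            ∏ v ∈ T, Nat.card (W.kummerSelmerStructure (p : ℤ) (Sum.inr v)) := by ring
      _ = _ := hpair
      _ = _ := by ring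
  -- conclude: `p^{#T₀} · #H¹_{𝓖*} · ∏ #𝓚_v ≤ #H¹_{𝓖*} · ∏ #𝓖_v = #H¹_𝓖 · ∏ #𝓚_v`
  have hkey : p ^ T₀.card *
        Nat.card (inv.dualSelmerStructure (W.torsionGaloisModule (p : ℤ)) 𝓖).selmerGroup *
        ∏ v ∈ T, Nat.card (W.kummerSelmerStructure (p : ℤ) (Sum.inr v)) ≤
      Nat.card 𝓖.selmerGroup *
        ∏ v ∈ T, Nat.card (W.kummerSelmerStructure (p : ℤ) (Sum.inr v)) := by
    rw [h1]
    calc p ^ T₀.card *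
          Nat.card (inv.dualSelmerStructure (W.torsionGaloisModule (p : ℤ)) 𝓖).selmerGroup *
          ∏ v ∈ T, Nat.card (W.kummerSelmerStructure (p : ℤ) (Sum.inr v))
        = Nat.card (inv.dualSelmerStructure (W.torsionGaloisModule (p : ℤ)) 𝓖).selmerGroup *
            (p ^ T₀.card * ∏ v ∈ T, Nat.card (W.kummerSelmerStructure (p : ℤ) (Sum.inr v))) := by
          ring
      _ ≤ Nat.card (inv.dualSelmerStructure (W.torsionGaloisModule (p : ℤ)) 𝓖).selmerGroup *
            ∏ v ∈ T, Nat.card (𝓖 (Sum.inr v)) := Nat.mul_le_mul_left _ hprod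
  have hG := Nat.le_of_mul_le_mul_right hkey hPK
  have hGd : 0 < Nat.card (inv.dualSelmerStructure (W.torsionGaloisModule (p : ℤ)) 𝓖).selmerGroup :=
    Nat.card_pos
  exact ⟨Nat.finite_of_card_ne_zero (Nat.pos_iff_ne_zero.mp
    (lt_of_lt_of_le (Nat.mul_pos (pow_pos hp.out.pos _) hGd) hG)), hfinGd, hG⟩

end Count

/-! ### §2 The strict-at-`T₀` Selmer classes inject into `H¹_{𝓖*}` by the Weil transport -/

section Strict

variable {K : Type u} [Field K] [NumberField K] (W : WeierstrassCurve K) [W.IsElliptic] (p : ℕ)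
  [hp : Fact p.Prime]

/-- **`#S₀ ≤ #H¹_{𝓖*}(K, E[p]^D)`** for the STRICT-at-`T₀` Selmer classes
`S₀ = {x ∈ H¹_𝓚(K, E[p]) : loc_v x = 0 for v ∈ T₀}` and any Selmer structure `𝓖` that agrees
with the Kummer structure `𝓚` at the finite places off `T₀` (`p` odd, `inv_v` injective, local
Euler–Poincaré): the Weil transport `θ_*` (`weilDualIntertwining`) carries `H¹_𝓚` into `H¹_{𝓚*}`
place by place (n1011-p18's `map_weilDual_mem_dualSelmerGroup`: `𝓚_v = θ⁻¹(𝓚_v^*)` at finite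
`v`, `H¹ = 0` at infinite places), hence `S₀` into `H¹_{𝓖*}` (`𝓖*_v = 𝓚*_v` off `T₀`,
`loc_v (θ_* x) = θ_*(loc_v x) = 0` on `T₀`), injectively (`θ` is invertible). [folklore] -/
theorem natCard_strict_le_natCard_dualSelmerGroup (hodd : p ≠ 2)
    (inv : LocalInvariants K p) (hinv : ∀ v : HeightOneSpectrum (𝓞 K), Injective (inv (Sum.inr v)))
    (hEP : ∀ v : HeightOneSpectrum (𝓞 K), localEulerPoincareCharacteristic (v.adicCompletion K))
    (𝓖 : SelmerStructure (W.torsionGaloisModule (p : ℤ))) (T₀ : Finset (HeightOneSpectrum (𝓞 K)))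
    (h𝓖off : ∀ v ∉ T₀, 𝓖 (Sum.inr v) = W.kummerSelmerStructure (p : ℤ) (Sum.inr v))
    [Finite (geomTorsion W (p : ℤ))]
    [Finite (inv.dualSelmerStructure (W.torsionGaloisModule (p : ℤ)) 𝓖).selmerGroup] :
    Nat.card {x : (W.kummerSelmerStructure (p : ℤ)).selmerGroup //
        ∀ v ∈ T₀, galoisCohomology.localization (W.torsionGaloisModule (p : ℤ)) (Sum.inr v) 1
          (x : galoisCohomology (W.torsionGaloisModule (p : ℤ)) 1) = 0} ≤
      Nat.card (inv.dualSelmerStructure (W.torsionGaloisModule (p : ℤ)) 𝓖).selmerGroup := by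
  haveI : NeZero p := ⟨hp.out.ne_zero⟩
  obtain ⟨e, hμ, hadd₁, hadd₂, halt, hnondeg, hgal⟩ :=
    exists_weilPairing_holds W p hp.out.two_le (Nat.cast_ne_zero.mpr hp.out.ne_zero)
  have hodd' : Odd p := hp.out.odd_of_ne_two hodd
  -- the Weil transport `θ_*` on `S₀`
  let θ := weilDualIntertwining W p e hμ hadd₁ hadd₂ hgal
  have hmem : ∀ x : {x : (W.kummerSelmerStructure (p : ℤ)).selmerGroup //
        ∀ v ∈ T₀, galoisCohomology.localization (W.torsionGaloisModule (p : ℤ)) (Sum.inr v) 1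
          (x : galoisCohomology (W.torsionGaloisModule (p : ℤ)) 1) = 0},
      galoisCohomology.map θ 1 (x.1 : galoisCohomology (W.torsionGaloisModule (p : ℤ)) 1) ∈
        (inv.dualSelmerStructure (W.torsionGaloisModule (p : ℤ)) 𝓖).selmerGroup := by
    intro x
    have hK := map_weilDual_mem_dualSelmerGroup W p e hμ hadd₁ hadd₂ hgal halt hnondeg
      hp.out.isPrimePow hodd' inv hinv hEP x.1.2
    rw [SelmerStructure.mem_selmerGroup_iff] at hK ⊢
    intro v
    rcases v with w | v
    · -- infinite place: the class vanishes (odd `p`)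
      rw [localization_map_one']
      set z := galoisCohomology.map (θ.restrictField (Place.Completion (Sum.inl w : Place K))) 1
        (galoisCohomology.localization _ (Sum.inl w) 1
          (x.1 : galoisCohomology (W.torsionGaloisModule (p : ℤ)) 1))
      have h0 : z = 0 :=
        galoisCohomology_one_tateDual_torsion_eq_zero_infinitePlace_of_odd W p hodd' w z
      rw [h0]; exact zero_mem _
    · by_cases hv : v ∈ T₀
      · rw [localization_map_one', x.2 v hv]
        convert zero_mem (inv.dualSelmerStructure (W.torsionGaloisModule (p : ℤ)) 𝓖 (Sum.inr v))
          using 1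
        exact map_zero _
      · have h := hK (Sum.inr v)
        rw [LocalInvariants.dualSelmerStructure_apply] at h ⊢
        rw [h𝓖off v hv]
        exact h
  let f : {x : (W.kummerSelmerStructure (p : ℤ)).selmerGroup //
        ∀ v ∈ T₀, galoisCohomology.localization (W.torsionGaloisModule (p : ℤ)) (Sum.inr v) 1
          (x : galoisCohomology (W.torsionGaloisModule (p : ℤ)) 1) = 0} →
      (inv.dualSelmerStructure (W.torsionGaloisModule (p : ℤ)) 𝓖).selmerGroup :=
    fun x ↦ ⟨_, hmem x⟩
  have hf : Injective f := fun x x' h ↦ Subtype.ext (Subtype.ext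
    (map_injective_of_comp_eq _ _ (weilDualInv_weilDualIntertwining W p e hμ hadd₁ hadd₂ hgal
      hnondeg) (congrArg Subtype.val h)))
  exact Nat.card_le_card_of_injective f hf

end Strict

/-! ### §3 The relaxed Kummer structure, joint count -/

section Relaxed

variable {K : Type} [Field K] [NumberField K] (W : WeierstrassCurve K) [W.IsElliptic] (p : ℕ)
  [hp : Fact p.Prime]

/-- **The relaxed-Kummer count, JOINT form.** As FILE 4a's `exists_addSubgroup_relaxedKummer`
(`p` odd, PT family, local Euler–Poincaré, Tamagawa witnesses on `T₀`), with the sharper bound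
`p^{#T₀} · #S₀ ≤ #S`, `S₀` the strict-at-`T₀` Selmer classes of `E[p]`
(`S = H¹_𝓖(K, E[p])` for the Kummer structure relaxed by the unramified classes on `T₀`;
§1 + §2). [cite: GreenbergLNM1716, §5 pp. 114–118] -/
theorem exists_addSubgroup_relaxedKummer_joint (hodd : p ≠ 2)
    (inv : LocalInvariants K p) (hperf : inv.IsPerfect) (hsum : inv.SumLocalTermEqZero)
    (hcompl : inv.SelmerComplement)
    (hEP : ∀ v : HeightOneSpectrum (𝓞 K), localEulerPoincareCharacteristic (v.adicCompletion K))
    (T₀ : Finset (HeightOneSpectrum (𝓞 K)))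
    (hwit : ∀ v ∈ T₀, ∃ u ∈ unramifiedSubgroup
        ((W.torsionGaloisModule (p : ℤ)).restrictField (v.adicCompletion K)) 1,
      u ∉ W.kummerLocalConditionAt (p : ℤ) (v.adicCompletion K)) :
    ∃ S : AddSubgroup (galH1Torsion W (p : ℤ)), Finite S ∧
      p ^ T₀.card * Nat.card {x : (W.kummerSelmerStructure (p : ℤ)).selmerGroup //
        ∀ v ∈ T₀, galoisCohomology.localization (W.torsionGaloisModule (p : ℤ)) (Sum.inr v) 1
          (x : galoisCohomology (W.torsionGaloisModule (p : ℤ)) 1) = 0} ≤ Nat.card S ∧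
      ∀ y ∈ S,
        (∀ v ∉ (↑T₀ : Set (HeightOneSpectrum (𝓞 K))),
            y ∈ selmerLocalKer W (v.adicCompletion K) (p : ℤ)) ∧
        (∀ w : InfinitePlace K, y ∈ selmerLocalKer W w.Completion (p : ℤ)) ∧
        ∀ v ∈ T₀, galoisCohomology.res (W.torsionGaloisModule (p : ℤ)) (v.adicCompletion K) 1 y ∈
          unramifiedSubgroup ((W.torsionGaloisModule (p : ℤ)).restrictField (v.adicCompletion K)) 1 ⊔
            W.kummerLocalConditionAt (p : ℤ) (v.adicCompletion K) := by
  haveI : NeZero p := ⟨hp.out.ne_zero⟩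
  haveI : Finite (geomTorsion W (p : ℤ)) := finite_geomTorsion_of_neZero W p
  -- a finite set `T ⊇ T₀ ∪ {bad} ∪ {v ∣ p}` of finite places
  have hbadfin : {v : HeightOneSpectrum (𝓞 K) | ¬ W.HasGoodReductionAt v}.Finite := by
    have h := W.eventually_hasGoodReductionAt
    rwa [Filter.eventually_cofinite] at h
  have hp0 : (Ideal.span {((p : ℕ) : 𝓞 K)} : Ideal (𝓞 K)) ≠ 0 := by
    rw [Ne, Ideal.zero_eq_bot, Ideal.span_singleton_eq_bot]
    exact_mod_cast hp.out.ne_zero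
  have hpfin : {v : HeightOneSpectrum (𝓞 K) | ((p : ℕ) : 𝓞 K) ∈ v.asIdeal}.Finite := by
    refine (Ideal.finite_factors hp0).subset fun v hv ↦ ?_
    exact (Ideal.dvd_span_singleton).mpr hv
  obtain ⟨T, hT₀T, hTp, hTbad⟩ : ∃ T : Finset (HeightOneSpectrum (𝓞 K)), T₀ ⊆ T ∧
      (∀ v, ((p : ℕ) : 𝓞 K) ∈ v.asIdeal → v ∈ T) ∧ ∀ v, ¬ W.HasGoodReductionAt v → v ∈ T :=
    ⟨T₀ ∪ (hbadfin.toFinset ∪ hpfin.toFinset), Finset.subset_union_left,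
      fun v hv ↦ Finset.mem_union_right _ (Finset.mem_union_right _ (hpfin.mem_toFinset.mpr hv)),
      fun v hv ↦ Finset.mem_union_right _ (Finset.mem_union_left _ (hbadfin.mem_toFinset.mpr hv))⟩
  have hS : ∀ v ∉ T, ((p : ℕ) : 𝓞 K) ∉ v.asIdeal ∧
      GaloisRep.IsUnramifiedAt v (W.torsionGaloisModule (p : ℤ)) := fun v hv ↦ by
    have hpv : ((p : ℕ) : 𝓞 K) ∉ v.asIdeal := fun h ↦ hv (hTp v h)
    have hgood : W.HasGoodReductionAt v := by_contra fun h ↦ hv (hTbad v h)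
    exact ⟨hpv, X11b.AcSelmer.isUnramifiedAt_torsionGaloisModule W hgood
      (by rw [Int.cast_natCast]; exact hpv)⟩
  have hfs_p : ∀ v : HeightOneSpectrum (𝓞 K), ((p : ℕ) : 𝓞 K) ∈ v.asIdeal →
      (Sum.inr v : Place K) ∈ finSupport T := fun v hv ↦ (inr_mem_finSupport_iff T v).mpr (hTp v hv)
  have hfs_bad : ∀ v : HeightOneSpectrum (𝓞 K), ¬ W.HasGoodReductionAt v →
      (Sum.inr v : Place K) ∈ finSupport T := fun v hv ↦ (inr_mem_finSupport_iff T v).mpr (hTbad v hv)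
  have h𝓚 : (W.kummerSelmerStructure (p : ℤ)).IsUnramifiedOutside (finSupport T) := by
    have h1 := X11b.KummerDuality.kummerSelmerStructure_isUnramifiedOutside W p 1
      (finSupport T) (inl_mem_finSupport T) hfs_p hfs_bad
    rwa [pow_one] at h1
  -- the relaxed structure `𝓖`: `H¹_ur + 𝓚_v` on `T₀`, `𝓚_v` elsewhere
  obtain ⟨𝓖, h𝓖inl, h𝓖T₀, h𝓖off⟩ : ∃ 𝓖 : SelmerStructure (W.torsionGaloisModule (p : ℤ)),
      (∀ w : InfinitePlace K, 𝓖 (Sum.inl w) = W.kummerSelmerStructure (p : ℤ) (Sum.inl w)) ∧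
      (∀ v ∈ T₀, 𝓖 (Sum.inr v) =
        unramifiedSubgroup (GaloisRep.toLocal v (W.torsionGaloisModule (p : ℤ))) 1 ⊔
          W.kummerSelmerStructure (p : ℤ) (Sum.inr v)) ∧
      (∀ v ∉ T₀, 𝓖 (Sum.inr v) = W.kummerSelmerStructure (p : ℤ) (Sum.inr v)) :=
    ⟨fun w ↦ match w with
      | Sum.inl w => W.kummerSelmerStructure (p : ℤ) (Sum.inl w)
      | Sum.inr v => if v ∈ T₀ then
          unramifiedSubgroup (GaloisRep.toLocal v (W.torsionGaloisModule (p : ℤ))) 1 ⊔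
            W.kummerSelmerStructure (p : ℤ) (Sum.inr v)
        else W.kummerSelmerStructure (p : ℤ) (Sum.inr v),
      fun _ ↦ rfl, fun v hv ↦ if_pos hv, fun v hv ↦ if_neg hv⟩
  have hle : W.kummerSelmerStructure (p : ℤ) ≤ 𝓖 := by
    rintro (w | v)
    · rw [h𝓖inl w]
    · by_cases hv : v ∈ T₀
      · rw [h𝓖T₀ v hv]; exact le_sup_right
      · rw [h𝓖off v hv]
  have h𝓖ur : 𝓖.IsUnramifiedOutside (finSupport T) := by
    refine ⟨inl_mem_finSupport T, fun v hv ↦ ?_⟩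
    have hvT : v ∉ T := fun h ↦ hv ((inr_mem_finSupport_iff T v).mpr h)
    rw [h𝓖off v fun h ↦ hvT (hT₀T h)]
    exact h𝓚.2 v hv
  have hbig : ∀ v ∈ T₀, p * Nat.card (W.kummerSelmerStructure (p : ℤ) (Sum.inr v)) ≤
      Nat.card (𝓖 (Sum.inr v)) := fun v hv ↦ by
    haveI := finite_galoisCohomology_one_toLocal (W.torsionGaloisModule (p : ℤ)) v
    obtain ⟨u, hu, huK⟩ := hwit v hv
    refine mul_card_le_card_of_lt (smul_galoisCohomology_toLocal_torsion_eq_zero W p v) ?_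
    rw [h𝓖T₀ v hv]
    exact right_lt_sup.mpr fun h ↦ huK (h hu)
  obtain ⟨hfin, hfinD, hcard⟩ := finite_and_pow_mul_card_dual_le_card_selmerGroup_of_kummer_le W p
    hodd inv hperf hsum hcompl hEP T hS h𝓚 hle h𝓖ur (fun w ↦ (h𝓖inl w).symm) T₀ hT₀T hbig
  haveI := hfinD
  have hstrict := natCard_strict_le_natCard_dualSelmerGroup W p hodd inv
    (fun v ↦ (hperf v).1.injective) hEP 𝓖 T₀ h𝓖off
  refine ⟨𝓖.selmerGroup, hfin, (Nat.mul_le_mul_left _ hstrict).trans hcard,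
    fun y hy ↦ ⟨fun v hv ↦ ?_, fun w ↦ ?_, fun v hv ↦ ?_⟩⟩
  · have h := (𝓖.mem_selmerGroup_iff y).mp hy (Sum.inr v)
    rw [h𝓖off v hv] at h
    have h' : y ∈ (W.kummerSelmerStructure (p : ℤ) (Sum.inr v)).comap
        (galoisCohomology.localization (W.torsionGaloisModule (p : ℤ)) (Sum.inr v) 1) := h
    rw [comap_localization_kummerSelmerStructure] at h'
    exact h'
  · have h := (𝓖.mem_selmerGroup_iff y).mp hy (Sum.inl w)
    rw [h𝓖inl w] at h
    have h' : y ∈ (W.kummerSelmerStructure (p : ℤ) (Sum.inl w)).comap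
        (galoisCohomology.localization (W.torsionGaloisModule (p : ℤ)) (Sum.inl w) 1) := h
    rw [comap_localization_kummerSelmerStructure] at h'
    exact h'
  · have h := (𝓖.mem_selmerGroup_iff y).mp hy (Sum.inr v)
    rw [h𝓖T₀ v hv] at h
    exact h

end Relaxed

end Summit.BirchSwinnertonDyer.Rank1Residual.Additive
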